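import Literature.MathematicalPhysics.QuantumFieldTheory.PlaquetteSystemLocalPressure
import Literature.MathematicalPhysics.QuantumFieldTheory.PlaquetteSystemRelabeling
import HarnessLib

/-!
# Local isomorphisms of plaquette–link systems transport the truncated local cluster sums

Topic `Literature/MathematicalPhysics/QuantumFieldTheory`; vocabulary of `PlaquetteSystemLocalPressure.lean` (`S.localClusterSum w R p` = the
anchored cluster sum at `p` truncated at total size `R`; `localClusterSum_eq_sum_ball`) and `PlaquetteSystemRelabeling.lean`
(`polymerActivity_image_eq`).  THEOREMS ONLY.  The abstract form of "clusters of different tori with the same local structure have the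
same weights" (R. Kotecký, D. Preiss, CMP 103 (1986) 491 [KoteckyPreiss1986] p. 493; the tree's `truncatedWeight_image`), packaged for
plaquette gases with the link-sharing incompatibility (planner ym-idea-4 RUNG-PLAN-K2, step K2-b «lifting lemma», in geometry-free form):

* `PlaquetteSystem.geomInc_image_iff` — the geometric incompatibility is transported by an injective, link-relation preserving relabeling;
* ★ `PlaquetteSystem.localClusterSum_eq_of_localIso` — if `S`, `S'` are isomorphic between the height balls `{ht < R}`, `{ht' < R}` about `p₀`,
  `φ p₀` (inverse bijections `φ`, `φ'`; `φ` preserves the link relation on the ball; `ψ` injective on the links of ball plaquettes with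
  `S'.edges ∘ φ = ψ(S.edges)`, `S'.hol U' (φ q) = S.hol (U' ∘ ψ) q`; `w' ∘ φ = w`), then `S.localClusterSum w R p₀ = S'.localClusterSum w' R (φ p₀)`
  inside the Kotecký–Preiss region.

HONEST FRAMING: bookkeeping identity; no estimate beyond what `PlaquetteSystemLocalPressure.lean` supplies.  Instance: the `2 : 1` time covering
of 't Hooft boxes (`FinTorusTimeCovering.lean`, `FinTorusAspectComparison.lean`).
-/

noncomputable section

open MeasureTheory Finset
open scoped BigOperators
open Literature.Probability.LatticeModels

namespace Literature.MathematicalPhysics.QuantumFieldTheory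

namespace PlaquetteSystem

variable {P E P' E' G : Type*} [Fintype P] [DecidableEq P] [Fintype E] [DecidableEq E] [Fintype P'] [DecidableEq P']
  [Fintype E'] [DecidableEq E'] [Group G] [TopologicalSpace G] [IsTopologicalGroup G] [CompactSpace G] [MeasurableSpace G]
  [BorelSpace G]

omit [Fintype P] [Fintype E] [DecidableEq E] [Fintype P'] [Fintype E'] [DecidableEq E'] [Group G] [TopologicalSpace G]
  [IsTopologicalGroup G] [CompactSpace G] [MeasurableSpace G] [BorelSpace G] in
/-- The geometric incompatibility is transported by a relabeling that is injective and link-relation preserving on the sets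
involved (plumbing). [cite: KoteckyPreiss1986, p. 493 (bulk free energy formula)] -/
theorem geomInc_image_iff (S : PlaquetteSystem P E G) (S' : PlaquetteSystem P' E' G) (φ : P → P') {X Y : Finset P}
    (hinj : Set.InjOn φ ↑(X ∪ Y)) (hlink : ∀ a ∈ X ∪ Y, ∀ b ∈ X ∪ Y, (S'.linkRel (φ a) (φ b) ↔ S.linkRel a b)) :
    GeomInc S'.linkRel (X.image φ) (Y.image φ) ↔ GeomInc S.linkRel X Y := by
  unfold GeomInc Touches
  constructor
  · rintro (hEq | ⟨a', ha', b', hb', hab⟩)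
    · left
      exact (Finset.image_eq_image_iff_of_injOn hinj Finset.subset_union_left Finset.subset_union_right).1 hEq
    · obtain ⟨a, ha, rfl⟩ := Finset.mem_image.1 ha'
      obtain ⟨b, hb, rfl⟩ := Finset.mem_image.1 hb'
      right
      refine ⟨a, ha, b, hb, ?_⟩
      rcases hab with h | h
      · exact Or.inl (hinj (Finset.mem_union_left _ ha) (Finset.mem_union_right _ hb) h)
      · exact Or.inr ((hlink a (Finset.mem_union_left _ ha) b (Finset.mem_union_right _ hb)).1 h)
  · rintro (rfl | ⟨a, ha, b, hb, hab⟩)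
    · exact Or.inl rfl
    · right
      refine ⟨φ a, Finset.mem_image_of_mem _ ha, φ b, Finset.mem_image_of_mem _ hb, ?_⟩
      rcases hab with rfl | h
      · exact Or.inl rfl
      · exact Or.inr ((hlink a (Finset.mem_union_left _ ha) b (Finset.mem_union_right _ hb)).2 h)

/-- **★ Local isomorphism ⇒ equal truncated local cluster sums.**  Let two plaquette–link systems `S`, `S'` with measurable KP-small
families `w`, `w'` be ISOMORPHIC between the height balls `{ht < R} ⊆ P` and `{ht' < R} ⊆ P'` (heights `1`-Lipschitz along the link
relations, vanishing at `p₀` resp. `φ p₀`): `φ`/`φ'` inverse bijections of the balls, `φ` link-relation preserving on the ball, `ψ`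
injective on the links of ball plaquettes with `S'.edges ∘ φ = ψ(S.edges)` and `S'.hol U' (φ q) = S.hol (U' ∘ ψ) q`, `w' ∘ φ = w`.  Then
the anchored cluster sums truncated at total size `R` agree: `g_R(p₀) = g'_R(φ p₀)` — every family through the anchor of total size `≤ R`
with `Φ^T ≠ 0` lives in the ball, where families, supports, incompatibility, polymer activities (`polymerActivity_image_eq`) and truncated
functionals (`truncatedWeight_image`) correspond.  This is the identification of clusters of two volumes with the same local structure,
[KP86] p. 493. [cite: KoteckyPreiss1986, p. 493 (bulk free energy formula)] -/
theorem localClusterSum_eq_of_localIso (S : PlaquetteSystem P E G) (S' : PlaquetteSystem P' E' G) {Δ : ℕ}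
    (hΔ : ∀ p, (S.nbrs p).card ≤ Δ) (hΔ' : ∀ p', (S'.nbrs p').card ≤ Δ)
    {w : P → G → ℝ} {w' : P' → G → ℝ} (hwm : ∀ p, Measurable (w p)) {ε : ℝ} (hε : ∀ p W, |w p W - 1| ≤ ε)
    (hε' : ∀ p' W, |w' p' W - 1| ≤ ε) (hsmall : ((Δ : ℝ) + 1) ^ 2 * (Real.exp 2 * ε) ≤ 1 / 2)
    (hmeas : ∀ p, Measurable fun U : E → G => S.hol U p)
    {ht : P → ℕ} {ht' : P' → ℕ} (hlip : ∀ a b, S.linkRel a b → ht b ≤ ht a + 1)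
    (hlip' : ∀ a b, S'.linkRel a b → ht' b ≤ ht' a + 1) (φ : P → P') (φ' : P' → P) (ψ : E → E') {R : ℕ} {p₀ : P}
    (hp₀ : ht p₀ = 0) (hp₀' : ht' (φ p₀) = 0)
    (hφB : ∀ q, ht q < R → ht' (φ q) < R) (hφ'B : ∀ q', ht' q' < R → ht (φ' q') < R)
    (hφφ' : ∀ q, ht q < R → φ' (φ q) = q) (hφ'φ : ∀ q', ht' q' < R → φ (φ' q') = q')
    (hlink : ∀ a b, ht a < R → ht b < R → (S'.linkRel (φ a) (φ b) ↔ S.linkRel a b))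
    (hψ : ∀ a b, ht a < R → ht b < R → ∀ e ∈ S.edges a, ∀ e' ∈ S.edges b, ψ e = ψ e' → e = e')
    (hedges : ∀ q, ht q < R → S'.edges (φ q) = (S.edges q).image ψ)
    (hhol : ∀ q, ht q < R → ∀ U' : E' → G, S'.hol U' (φ q) = S.hol (U' ∘ ψ) q) (hww' : ∀ q, ht q < R → w' (φ q) = w q) :
    S.localClusterSum w R p₀ = S'.localClusterSum w' R (φ p₀) := by
  rw [S.localClusterSum_eq_sum_ball hΔ hε hsmall hlip hp₀ R, S'.localClusterSum_eq_sum_ball hΔ' hε' hsmall hlip' hp₀' R]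
  set B := (Finset.univ : Finset P).filter fun q => ht q < R with hB
  set B' := (Finset.univ : Finset P').filter fun q => ht' q < R with hB'
  have memB : ∀ {q}, q ∈ B ↔ ht q < R := fun {q} => by simp [hB]
  have memB' : ∀ {q}, q ∈ B' ↔ ht' q < R := fun {q} => by simp [hB']
  have φ_inj : Set.InjOn φ ↑B := fun a ha b hb h => by
    have := congrArg φ' h
    rwa [hφφ' a (memB.1 ha), hφφ' b (memB.1 hb)] at this
  have imX : ∀ {X : Finset P}, X ⊆ B → (X.image φ).image φ' = X := by
    intro X hX
    rw [Finset.image_image]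
    conv_rhs => rw [← Finset.image_id (s := X)]
    exact Finset.image_congr fun q hq => by simpa using hφφ' q (memB.1 (hX hq))
  have imX' : ∀ {X' : Finset P'}, X' ⊆ B' → (X'.image φ').image φ = X' := by
    intro X' hX'
    rw [Finset.image_image]
    conv_rhs => rw [← Finset.image_id (s := X')]
    exact Finset.image_congr fun q hq => by simpa using hφ'φ q (memB'.1 (hX' hq))
  refine Finset.sum_nbij' (fun C => C.image (Finset.image φ)) (fun C' => C'.image (Finset.image φ')) ?_ ?_ ?_ ?_ ?_
  · -- maps into
    intro C hC
    rw [Finset.mem_filter, Finset.mem_powerset] at hC ⊢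
    obtain ⟨hCB, hpC, hsize⟩ := hC
    have hXB : ∀ X ∈ C, X ⊆ B := fun X hX => Finset.mem_powerset.1 (hCB hX)
    refine ⟨fun X' hX' => ?_, ?_, ?_⟩
    · obtain ⟨X, hX, rfl⟩ := Finset.mem_image.1 hX'
      exact Finset.mem_powerset.2 fun q' hq' => by
        obtain ⟨q, hq, rfl⟩ := Finset.mem_image.1 hq'
        exact memB'.2 (hφB q (memB.1 (hXB X hX hq)))
    · obtain ⟨X, hX, hpX⟩ := mem_clusterSupp.1 hpC
      exact mem_clusterSupp.2 ⟨X.image φ, Finset.mem_image_of_mem _ hX, Finset.mem_image_of_mem _ hpX⟩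
    · rw [Finset.sum_image fun X hX Y hY h => by rw [← imX (hXB X hX), ← imX (hXB Y hY), h]]
      refine le_trans (le_of_eq (Finset.sum_congr rfl fun X hX => ?_)) hsize
      exact Finset.card_image_of_injOn (φ_inj.mono (Finset.coe_subset.2 (hXB X hX)))
  · -- the inverse maps into
    intro C' hC'
    rw [Finset.mem_filter, Finset.mem_powerset] at hC' ⊢
    obtain ⟨hCB, hpC, hsize⟩ := hC'
    have hXB : ∀ X' ∈ C', X' ⊆ B' := fun X hX => Finset.mem_powerset.1 (hCB hX)
    refine ⟨fun X hX => ?_, ?_, ?_⟩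
    · obtain ⟨X', hX', rfl⟩ := Finset.mem_image.1 hX
      exact Finset.mem_powerset.2 fun q hq => by
        obtain ⟨q', hq', rfl⟩ := Finset.mem_image.1 hq
        exact memB.2 (hφ'B q' (memB'.1 (hXB X' hX' hq')))
    · obtain ⟨X', hX', hpX⟩ := mem_clusterSupp.1 hpC
      have hR0 : 0 < R := by
        have h1 := memB'.1 (hXB X' hX' hpX)
        omega
      have hfix : φ' (φ p₀) = p₀ := hφφ' p₀ (by omega)
      refine mem_clusterSupp.2 ⟨X'.image φ', Finset.mem_image_of_mem _ hX', ?_⟩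
      rw [← hfix]
      exact Finset.mem_image_of_mem _ hpX
    · have hinj : ∀ X' ∈ C', ∀ Y' ∈ C', X'.image φ' = Y'.image φ' → X' = Y' :=
        fun X' hX' Y' hY' h => by rw [← imX' (hXB X' hX'), ← imX' (hXB Y' hY'), h]
      rw [Finset.sum_image hinj]
      refine le_trans (le_of_eq (Finset.sum_congr rfl fun X' hX' => ?_)) hsize
      refine Finset.card_image_of_injOn fun a ha b hb h => ?_
      have := congrArg φ h
      rwa [hφ'φ a (memB'.1 (hXB X' hX' ha)), hφ'φ b (memB'.1 (hXB X' hX' hb))] at this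
  · -- left inverse
    intro C hC
    rw [Finset.mem_filter, Finset.mem_powerset] at hC
    have hXB : ∀ X ∈ C, X ⊆ B := fun X hX => Finset.mem_powerset.1 (hC.1 hX)
    rw [Finset.image_image]
    conv_rhs => rw [← Finset.image_id (s := C)]
    exact Finset.image_congr fun X hX => by simpa using imX (hXB X hX)
  · -- right inverse
    intro C' hC'
    rw [Finset.mem_filter, Finset.mem_powerset] at hC'
    have hXB : ∀ X' ∈ C', X' ⊆ B' := fun X hX => Finset.mem_powerset.1 (hC'.1 hX)
    rw [Finset.image_image]
    conv_rhs => rw [← Finset.image_id (s := C')]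
    exact Finset.image_congr fun X' hX' => by simpa using imX' (hXB X' hX')
  · -- the summands agree
    intro C hC
    rw [Finset.mem_filter, Finset.mem_powerset] at hC
    have hXB : ∀ X ∈ C, X ⊆ B := fun X hX => Finset.mem_powerset.1 (hC.1 hX)
    have hball : ∀ X ∈ C, ∀ q ∈ X, ht q < R := fun X hX q hq => memB.1 (hXB X hX hq)
    have hsupp : clusterSupp (C.image (Finset.image φ)) = (clusterSupp C).image φ := by
      unfold clusterSupp
      rw [Finset.image_biUnion, Finset.biUnion_image]
      rfl
    have hsuppB : clusterSupp C ⊆ B := fun q hq => by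
      obtain ⟨X, hX, hqX⟩ := mem_clusterSupp.1 hq
      exact hXB X hX hqX
    have hcard : (clusterSupp (C.image (Finset.image φ))).card = (clusterSupp C).card := by
      rw [hsupp]
      exact Finset.card_image_of_injOn (φ_inj.mono (Finset.coe_subset.2 hsuppB))
    have hΦ : truncatedWeight (GeomInc S'.linkRel) (S'.polymerActivity w') (C.image (Finset.image φ)) =
        truncatedWeight (GeomInc S.linkRel) (S.polymerActivity w) C := by
      classical
      refine truncatedWeight_image (fun X hX Y hY h => ?_) (fun X hX Y hY => ?_) (fun X hX => ?_)
      · rw [← imX (hXB X hX), ← imX (hXB Y hY), h]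
      · refine S.geomInc_image_iff S' φ (φ_inj.mono ?_) fun a ha b hb => hlink a b ?_ ?_
        · rw [Finset.coe_union]
          exact Set.union_subset (Finset.coe_subset.2 (hXB X hX)) (Finset.coe_subset.2 (hXB Y hY))
        · exact (Finset.mem_union.1 ha).elim (hball X hX a) (hball Y hY a)
        · exact (Finset.mem_union.1 hb).elim (hball X hX b) (hball Y hY b)
      · refine S.polymerActivity_image_eq S' φ ψ (φ_inj.mono (Finset.coe_subset.2 (hXB X hX)))
          (fun a ha b hb h => ?_) (fun q hq => hedges q (hball X hX q hq)) (fun q hq U' => hhol q (hball X hX q hq) U')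
          hmeas (fun q hq => hww' q (hball X hX q hq)) hwm
        obtain ⟨qa, hqa, ha'⟩ := Finset.mem_biUnion.1 (Finset.mem_coe.1 ha)
        obtain ⟨qb, hqb, hb'⟩ := Finset.mem_biUnion.1 (Finset.mem_coe.1 hb)
        exact hψ qa qb (hball X hX qa hqa) (hball X hX qb hqb) _ ha' _ hb' h
    rw [hΦ, hcard]

end PlaquetteSystem

end Literature.MathematicalPhysics.QuantumFieldTheory

end
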